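import Mathlib

/-!
# Solo-blind O1b, E77: the new Eisenstein line at level `q₁ q₂` — mixedness and the conic

Algebraic kernels of §5(q)(E6) of the solo-blind Eisenstein study (`paper/theoremPhi.md`).

At level `N = q₁ q₂` (`qᵢ ≡ 1 (mod ℓ)`, rank-one old quotients) the three cusp forms `f, g, h`
congruent to the Eisenstein series have second `ℓ`-adic digits
`a_p(x) ≡ 1 + p + ℓ (1 - p) (s_x ψ₁(p) + r_x ψ₂(p)) (mod ℓ²)` with canonical vectors
`w_f = (κ_f, 0)`, `w_g = (0, κ_g)`, `w_h = (s, r)`.  Writing `A = (κ_f, 0, s)`, `B = (0, κ_g, r)` for the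
coefficient vectors of `ψ₁`, `ψ₂` in `T⁰ ⊂ ℤ_ℓ³`, the square of the Eisenstein ideal is governed by the
coordinatewise products `A∘A, A∘B, B∘B`;  **E77a** computes their determinant, `-(κ_f² κ_g² s r)`, so that
(**E77b**) they span `𝔽_ℓ³` iff the new line is MIXED (`s ≠ 0 ∧ r ≠ 0`) — the link between
`#(I⁰/I⁰²) = ℓ²` (Wake–Wang-Erickson) and (E6)(iii).

**E77c–e** are the axis structure of the conic of LAW Z2,
`F(s,r) = -K₁₂ m₁ s² + c₁₁ s r - K₂₁ m₂ r² + (u₂ m₁ + K₁₂ u₁ c) s + (u₁ m₂ + K₂₁ u₂ c) r - u₁ u₂ c`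
(`c` standing for `1/12`): on the axis `r = 0` it factorises as `-(K₁₂ s - u₂)(m₁ s - u₁ c)`, so its
axis points are the EULER POINT `s = u₂ / K₁₂` and the MAZUR POINT `s = κ_f` with `m₁ κ_f = u₁ c`
(Mazur–Merel: `κ_f m₁ ≡ (q₁ - 1)/(12 ℓ)`), and on the vertical line through the Mazur point the second
coordinate satisfies the linear equation **E77e**.
-/

namespace Summit.Langlands.Langlands.Theorems

open Matrix

/-- **E77a.** The determinant of the coordinatewise products `A∘A = (κf², 0, s²)`,
`A∘B = (0, 0, s r)`, `B∘B = (0, κg², r²)`. -/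
theorem soloBlind_newLine_det {R : Type*} [CommRing R] (κf κg s r : R) :
    Matrix.det !![κf ^ 2, 0, s ^ 2; 0, 0, s * r; 0, κg ^ 2, r ^ 2] = -(κf ^ 2 * κg ^ 2 * s * r) := by
  simp [Matrix.det_fin_three]
  ring

/-- **E77b.** Over a field, with `κf κg ≠ 0`, the three product vectors span (non-zero determinant)
iff the new line is mixed: `s ≠ 0` and `r ≠ 0`. -/
theorem soloBlind_newLine_mixed_iff {F : Type*} [Field F] {κf κg : F} (hf : κf ≠ 0) (hg : κg ≠ 0)
    (s r : F) :
    Matrix.det !![κf ^ 2, 0, s ^ 2; 0, 0, s * r; 0, κg ^ 2, r ^ 2] ≠ 0 ↔ (s ≠ 0 ∧ r ≠ 0) := by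
  rw [soloBlind_newLine_det]
  constructor
  · intro h
    refine ⟨fun hs => h ?_, fun hr => h ?_⟩
    · simp [hs]
    · simp [hr]
  · rintro ⟨hs, hr⟩
    have : κf ^ 2 * κg ^ 2 * s * r ≠ 0 := by
      apply mul_ne_zero (mul_ne_zero (mul_ne_zero (pow_ne_zero 2 hf) (pow_ne_zero 2 hg)) hs) hr
    exact neg_ne_zero.mpr this

/-- The conic of LAW Z2 (with `c` in place of `1/12`). -/
def soloBlindConic {R : Type*} [CommRing R] (K₁₂ K₂₁ m₁ m₂ u₁ u₂ c c₁₁ s r : R) : R :=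
  -(K₁₂ * m₁) * s ^ 2 + c₁₁ * s * r - (K₂₁ * m₂) * r ^ 2
    + (u₂ * m₁ + K₁₂ * u₁ * c) * s + (u₁ * m₂ + K₂₁ * u₂ * c) * r - u₁ * u₂ * c

/-- **E77c (axis factorisation).** On the axis `r = 0` the conic is `-(K₁₂ s - u₂)(m₁ s - u₁ c)`. -/
theorem soloBlind_conic_axis {R : Type*} [CommRing R] (K₁₂ K₂₁ m₁ m₂ u₁ u₂ c c₁₁ s : R) :
    soloBlindConic K₁₂ K₂₁ m₁ m₂ u₁ u₂ c c₁₁ s 0 = -((K₁₂ * s - u₂) * (m₁ * s - u₁ * c)) := by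
  unfold soloBlindConic
  ring

/-- **E77d (the two axis points).** Over a field: the Euler point `s = u₂ / K₁₂` (`K₁₂ ≠ 0`) and the
Mazur point `s = κ` with `m₁ κ = u₁ c` lie on the conic. -/
theorem soloBlind_conic_axis_points {F : Type*} [Field F] (K₁₂ K₂₁ m₁ m₂ u₁ u₂ c c₁₁ κ : F)
    (hK : K₁₂ ≠ 0) (hκ : m₁ * κ = u₁ * c) :
    soloBlindConic K₁₂ K₂₁ m₁ m₂ u₁ u₂ c c₁₁ (u₂ / K₁₂) 0 = 0 ∧
      soloBlindConic K₁₂ K₂₁ m₁ m₂ u₁ u₂ c c₁₁ κ 0 = 0 := by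
  constructor
  · rw [soloBlind_conic_axis]
    have : K₁₂ * (u₂ / K₁₂) - u₂ = 0 := by rw [mul_div_cancel₀ u₂ hK]; ring
    rw [this]; ring
  · rw [soloBlind_conic_axis, hκ]; ring

/-- **E77e (the vertical line through the Mazur point).** If `m₁ κ = u₁ c` then
`F(κ, r) = r · (-(K₂₁ m₂) r + u₁ m₂ + K₂₁ u₂ c + c₁₁ κ)`: besides `r = 0` (the point `P_f`, a deep
congruence `h ≡ f`) the conic meets that line in exactly the root of the displayed linear form. -/
theorem soloBlind_conic_mazur_line {R : Type*} [CommRing R] (K₁₂ K₂₁ m₁ m₂ u₁ u₂ c c₁₁ κ r : R)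
    (hκ : m₁ * κ = u₁ * c) :
    soloBlindConic K₁₂ K₂₁ m₁ m₂ u₁ u₂ c c₁₁ κ r =
      r * (-(K₂₁ * m₂) * r + u₁ * m₂ + K₂₁ * u₂ * c + c₁₁ * κ) := by
  unfold soloBlindConic
  have h2 : m₁ * κ - u₁ * c = 0 := by rw [hκ]; ring
  linear_combination (-(K₁₂ * κ - u₂)) * h2

end Summit.Langlands.Langlands.Theorems
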